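import Literature.Probability.LatticeModels.BlockExplorationNested
import Literature.Probability.LatticeModels.RandomClusterRimWiringOutside
import HarnessLib

/-!
# One level of Kesten's chain for the random-cluster measure, rim wired OFF the inside (proved)

Topic `Literature/Probability/LatticeModels`; companion of `BlockExplorationChain.lean` (the same
two statements with the inner rim wired through the WHOLE inner explored set), of
`BlockExplorationNested.lean` (combinatorics of a nested pair of exploration data, D. Basu,
A. Sapozhnikov, ECP 22 (2017), §2) and of `RandomClusterRimWiringOutside.lean` (conditional
independence of the configurations on and off the edges touching an explored set whose rim is
wired from inside).

Fix a finite graph `G`, the free random-cluster measure `φ = φ^∅_{G,p,q}` (`0 ≤ p ≤ 1`, `q > 0`),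
an outer explored set `U` with outer rim `R` and an anchor `x`. For an inner datum `(U', R')`
(inner explored set `U' ∋ x` of the block `Blk'` from `In'`, inner rim `R'`) the rim is required to
be WIRED OFF THE INSIDE: any two rim vertices hang, through open edges, off two vertices of
`U' ∖ In'` joined by an open path inside `U' ∖ In'` (in Basu–Sapozhnikov this wiring is supplied by
the unique crossing cluster of the annulus `Blk' ∖ In'`, so that the datum event is determined by
the edges avoiding `In'` and the decomposition NESTS). Write `F = F(U', R')` for the saturated
datum event so wired, `InU = {x is joined inside U to a vertex carrying an open edge to R}` (the
inside piece of the outer level), `InU'` for the inside piece of the inner level and `Mid` for the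
middle piece (some inner-rim vertex is joined inside `U ∖ U'` to a vertex carrying an open edge
to `R`).

* `insidePiece_factorisation_off` (CH-prob): for a context event `Fo` determined off the edges
  `T` touching `U'`, `φ(F ∩ Fo ∩ InU) · φ(F) = φ(F ∩ InU') · φ(F ∩ Fo ∩ Mid)`.
* `insidePiece_eq_sum_add_notWiredOff` (CH-sum): summing over all inner data,
  `φ(Fo ∩ InU) = Σ_{d'} φ(F(d') ∩ Fo ∩ Mid(d')) · u_x(d') + φ(Fo ∩ InU ∩ {rim not wired off In'})`
  with the CONDITIONAL inside probability `u_x(d') = φ(F(d') ∩ InU'(d')) / φ(F(d'))` — Kesten's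
  one-level chain identity (PTRF 73 (1986), proof of Thm. 3, eqs. (16)–(19)) in the
  planarity-free form of Basu–Sapozhnikov (§2, eqs. (2.5)–(2.7)).

The wiring off the inside implies the wiring through `U'` (`openConnIn` is monotone in its set),
so the Markov bricks of `RandomClusterRimWiringOutside.lean` and the combinatorial identity
`insidePiece_iff_of_nested_explEvent` apply verbatim; only the determinacy of `F` by the edges
touching `U'` is re-checked for the new clause. Everything is proved; no definitions.

## References
* [BasuSapozhnikov2017ECP] D. Basu, A. Sapozhnikov, *Kesten's incipient infinite cluster and
  quasi-multiplicativity of crossing probabilities*, Electron. Commun. Probab. 22 (2017) no. 26,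
  §2, eqs. (2.5)–(2.7).
* [Kesten1986] H. Kesten, The incipient infinite cluster in two-dimensional percolation,
  *Probab. Theory Related Fields* 73 (1986) 369–394, proof of Thm. 3, eqs. (16)–(19).
* [Grimmett2006] G. Grimmett, *The Random-Cluster Model*, Springer (2006), Lemma (4.13).
-/

open MeasureTheory Finset SimpleGraph
open Literature.Probability.Percolation (BondConfig openConnIn explSet explRim explEvent explRimWired)

namespace Literature.Probability.LatticeModels

/-- The rim wired OFF the inside (`R'` pairwise hung off `U' ∖ In'`, joined inside `U' ∖ In'`) is
wired through `U'`: `openConnIn` is monotone in its set. [folklore] -/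
private theorem rimWired_of_rimWiredOff {V : Type*} {In' U' R' : Set V} {ω : BondConfig V}
    (h : ∀ r ∈ R', ∀ r₂ ∈ R', ∃ v ∈ U' \ In', ∃ v' ∈ U' \ In',
      s(v, r) ∈ ω ∧ s(v', r₂) ∈ ω ∧ ω ∈ openConnIn (U' \ In') v v') :
    ∀ r ∈ R', ∀ r₂ ∈ R', ∃ v ∈ U', ∃ v' ∈ U',
      s(v, r) ∈ ω ∧ s(v', r₂) ∈ ω ∧ ω ∈ openConnIn U' v v' := fun r hr r₂ hr₂ => by
  obtain ⟨v, hv, v', hv', h1, h2, h3⟩ := h r hr r₂ hr₂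
  exact ⟨v, hv.1, v', hv'.1, h1, h2, Percolation.openConnIn_mono Set.sdiff_subset _ _ h3⟩

/-- **The saturated datum event wired off the inside satisfies the hypotheses of the rim-wiring
Markov property** (the analogue of `explEvent_wired_rimHyps`). With `T` the `G`-edges touching
`U'` and `F = {ω | ω ∩ E(G) ∈ explEvent In' Blk' U' R' ∩ {rim wired off In'}}`: (1) `F` is
determined by `ω ∩ T` (the new wiring clause only looks at pairs with an endpoint in
`U' ∖ In' ⊆ U'`); (2) an open `T`-edge of a configuration of `F` leaves `U'` only into `R'`;
(3) any two vertices of `R'` are joined in `fromEdgeSet (ω ∩ T)` — (2), (3) from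
`explEvent_wired_rimHyps`, the new clause implying the old one.
[cite: Kesten1986, proof of Thm. 3, eqs. (16)–(19)] -/
private theorem explEvent_wiredOff_rimHyps {V : Type*} [Fintype V] [DecidableEq V]
    (G : SimpleGraph V) [DecidableRel G.Adj] (In' Blk' U' R' : Set V) (T : Finset (Sym2 V))
    (hT : ∀ e, e ∈ T ↔ e ∈ G.edgeFinset ∧ ∃ v ∈ U', v ∈ e) :
    let F : Set (BondConfig V) := {ω | ω ∩ (↑G.edgeFinset : Set (Sym2 V)) ∈
      explEvent In' Blk' U' R' ∩ {ω | ∀ r ∈ R', ∀ r₂ ∈ R', ∃ v ∈ U' \ In', ∃ v' ∈ U' \ In',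
        s(v, r) ∈ ω ∧ s(v', r₂) ∈ ω ∧ ω ∈ openConnIn (U' \ In') v v'}}
    (∀ ω₁ ω₂ : BondConfig V, ω₁ ∩ ↑T = ω₂ ∩ ↑T → (ω₁ ∈ F ↔ ω₂ ∈ F)) ∧
      (∀ ω ∈ F, ∀ e ∈ ω, e ∈ T → ∀ x ∈ e, x ∉ U' → x ∈ R') ∧
      (∀ ω ∈ F, ∀ x ∈ R', ∀ y ∈ R', (fromEdgeSet (ω ∩ ↑T)).Reachable x y) := by
  intro F
  obtain ⟨-, hFrim, hFwire⟩ := explEvent_wired_rimHyps G In' Blk' U' R' T hT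
  -- `F` is contained in the datum event wired through `U'`
  have hsubF : ∀ ω ∈ F, ω ∩ (↑G.edgeFinset : Set (Sym2 V)) ∈ explEvent In' Blk' U' R' ∩
      {ω | ∀ r ∈ R', ∀ r₂ ∈ R', ∃ v ∈ U', ∃ v' ∈ U',
        s(v, r) ∈ ω ∧ s(v', r₂) ∈ ω ∧ ω ∈ openConnIn U' v v'} :=
    fun ω hω => ⟨hω.1, rimWired_of_rimWiredOff hω.2⟩
  -- the wiring clause passes between configurations agreeing on the pairs touching `U'`
  have hwire : ∀ {ωa ωb : BondConfig V},
      (∀ e : Sym2 V, (∃ v ∈ U', v ∈ e) → (e ∈ ωa ↔ e ∈ ωb)) →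
      (∀ r ∈ R', ∀ r₂ ∈ R', ∃ v ∈ U' \ In', ∃ v' ∈ U' \ In',
        s(v, r) ∈ ωa ∧ s(v', r₂) ∈ ωa ∧ ωa ∈ openConnIn (U' \ In') v v') →
      ∀ r ∈ R', ∀ r₂ ∈ R', ∃ v ∈ U' \ In', ∃ v' ∈ U' \ In',
        s(v, r) ∈ ωb ∧ s(v', r₂) ∈ ωb ∧ ωb ∈ openConnIn (U' \ In') v v' := by
    intro ωa ωb hag h r hr r₂ hr₂
    obtain ⟨v, hv, v', hv', h1, h2, h3⟩ := h r hr r₂ hr₂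
    exact ⟨v, hv, v', hv', (hag _ ⟨v, hv.1, Sym2.mem_mk_left v r⟩).1 h1,
      (hag _ ⟨v', hv'.1, Sym2.mem_mk_left v' r₂⟩).1 h2,
      Percolation.BlockExploration.openConnIn_of_agree h3 fun a ha b _ hab =>
        (hag _ ⟨a, ha.1, Sym2.mem_mk_left a b⟩).1 hab⟩
  refine ⟨fun ω₁ ω₂ h12 => ?_, fun ω hω => hFrim ω (hsubF ω hω),
    fun ω hω => hFwire ω (hsubF ω hω)⟩
  -- (1) the saturated configurations agree on every pair touching `U'`
  have hag : ∀ e : Sym2 V, (∃ v ∈ U', v ∈ e) →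
      (e ∈ ω₁ ∩ (↑G.edgeFinset : Set (Sym2 V)) ↔ e ∈ ω₂ ∩ (↑G.edgeFinset : Set (Sym2 V))) := by
    intro e he
    by_cases heE : e ∈ G.edgeFinset
    · have heT : e ∈ T := (hT e).2 ⟨heE, he⟩
      have h : e ∈ ω₁ ∩ (↑T : Set (Sym2 V)) ↔ e ∈ ω₂ ∩ (↑T : Set (Sym2 V)) := by rw [h12]
      simp only [Set.mem_inter_iff, Finset.mem_coe, heT, and_true] at h
      simp only [Set.mem_inter_iff, Finset.mem_coe, heE, and_true]
      exact h
    · simp only [Set.mem_inter_iff, Finset.mem_coe, heE, and_false]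
  show ω₁ ∩ ↑G.edgeFinset ∈ explEvent In' Blk' U' R' ∩ _ ↔
    ω₂ ∩ ↑G.edgeFinset ∈ explEvent In' Blk' U' R' ∩ _
  rw [Set.mem_inter_iff, Set.mem_inter_iff,
    Percolation.mem_explEvent_iff_of_agree_on_touching hag]
  exact and_congr_right fun _ => ⟨hwire hag, hwire fun e he => (hag e he).symm⟩

/-- **(CH-prob, rim wired off the inside) Factorisation of the outer inside piece at a nested
inner datum** (free random-cluster measure). With `F` the saturated event
`{ω | ω ∩ E(G) ∈ {𝒞 = U', 𝒟 = R'} ∩ {rim wired through U' ∖ In'}}`, `T` the `G`-edges touching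
`U'`, `Fo` any event determined off `T`, `InU`, `InU'`, `Mid` the outer inside piece, the inner
inside piece and the middle piece (all read on `ω ∩ E(G)`):
`φ(F ∩ Fo ∩ InU) · φ(F) = φ(F ∩ InU') · φ(F ∩ Fo ∩ Mid)`. Proof: the wiring off the inside implies
the wiring through `U'`, so as sets `F ∩ InU = F ∩ InU' ∩ Mid`
(`insidePiece_iff_of_nested_explEvent`); `InU'` is determined by `ω ∩ T`, `Fo ∩ Mid` by
`ω ∩ (E(G) ∖ T)`, and given `F` these are conditionally independent
(`rcMeasure_real_condIndep_of_rim_wired_outside`). [cite: BasuSapozhnikov2017ECP, §2 eqs. (2.5)–(2.7)] -/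
theorem insidePiece_factorisation_off :
    ∀ {V : Type*} [Fintype V] [DecidableEq V] (G : SimpleGraph V) [DecidableRel G.Adj] {p q : ℝ},
      p ∈ Set.Icc (0 : ℝ) 1 → 0 < q →
    ∀ (In' Blk' U' R' U R : Set V) (T : Finset (Sym2 V)),
      (∀ e, e ∈ T ↔ e ∈ G.edgeFinset ∧ ∃ v ∈ U', v ∈ e) →
      U' ⊆ U → R' ⊆ U → (∀ r ∈ R, r ∉ U' ∧ r ∉ R') →
    ∀ (x : V), x ∈ U' →
    ∀ (Fo : Set (BondConfig V)),
      (∀ ω₁ ω₂ : BondConfig V, ω₁ ∩ (↑(G.edgeFinset \ T)) = ω₂ ∩ (↑(G.edgeFinset \ T)) → (ω₁ ∈ Fo ↔ ω₂ ∈ Fo)) →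
      let Eg : Set (Sym2 V) := ↑G.edgeFinset
      let F : Set (BondConfig V) := {ω | ω ∩ Eg ∈ explEvent In' Blk' U' R' ∩
        {ω | ∀ r ∈ R', ∀ r₂ ∈ R', ∃ v ∈ U' \ In', ∃ v' ∈ U' \ In', s(v, r) ∈ ω ∧ s(v', r₂) ∈ ω ∧ ω ∈ openConnIn (U' \ In') v v'}}
      let InU : Set (BondConfig V) := {ω | ∃ w ∈ R, ∃ v ∈ U, ω ∩ Eg ∈ openConnIn U x v ∧ s(v, w) ∈ ω ∩ Eg}
      let InU' : Set (BondConfig V) := {ω | ∃ w' ∈ R', ∃ v' ∈ U', ω ∩ Eg ∈ openConnIn U' x v' ∧ s(v', w') ∈ ω ∩ Eg}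
      let Mid : Set (BondConfig V) :=
        {ω | ∃ w'' ∈ R', ∃ v ∈ U, ∃ w ∈ R, ω ∩ Eg ∈ openConnIn (U \ U') w'' v ∧ s(v, w) ∈ ω ∩ Eg}
      (rcMeasure G p q ∅).real (F ∩ Fo ∩ InU) * (rcMeasure G p q ∅).real F =
        (rcMeasure G p q ∅).real (F ∩ InU') * (rcMeasure G p q ∅).real (F ∩ Fo ∩ Mid) := by
  intro V _ _ G _ p q hp hq In' Blk' U' R' U R T hT hU'U hR'U hR x hx Fo hFo Eg F InU InU' Mid
  /- (i) the combinatorial identity `F ∩ InU = F ∩ InU' ∩ Mid`, read on `ω ∩ E(G)`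
  (the wiring off the inside implies the wiring through `U'`) -/
  have hset : F ∩ InU = F ∩ InU' ∩ Mid := by
    ext ω
    constructor
    · rintro ⟨hF, hIn⟩
      have key := insidePiece_iff_of_nested_explEvent hF.1 (rimWired_of_rimWiredOff hF.2) hU'U
        hR'U hR hx
      exact ⟨⟨hF, (key.1 hIn).1⟩, (key.1 hIn).2⟩
    · rintro ⟨⟨hF, h1⟩, h2⟩
      exact ⟨hF, (insidePiece_iff_of_nested_explEvent hF.1 (rimWired_of_rimWiredOff hF.2) hU'U
        hR'U hR hx).2 ⟨h1, h2⟩⟩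
  /- an open `G`-edge issuing from `U'` is read on `T` -/
  have hagA : ∀ {ω₁ ω₂ : BondConfig V}, ω₁ ∩ ↑T = ω₂ ∩ ↑T →
      ∀ a ∈ U', ∀ b : V, s(a, b) ∈ ω₁ ∩ Eg → s(a, b) ∈ ω₂ ∩ Eg := by
    rintro ω₁ ω₂ h a ha b ⟨hab, habE⟩
    have habT : s(a, b) ∈ ω₁ ∩ (↑T : Set (Sym2 V)) :=
      ⟨hab, Finset.mem_coe.2 ((hT _).2 ⟨habE, a, ha, Sym2.mem_mk_left a b⟩)⟩
    rw [h] at habT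
    exact ⟨habT.1, habE⟩
  /- (ii) `InU'` is determined by `ω ∩ T` -/
  have hA : ∀ ω₁ ω₂ : BondConfig V, ω₁ ∩ ↑T = ω₂ ∩ ↑T → (ω₁ ∈ InU' ↔ ω₂ ∈ InU') := by
    have aux : ∀ ω₁ ω₂ : BondConfig V, ω₁ ∩ ↑T = ω₂ ∩ ↑T → ω₁ ∈ InU' → ω₂ ∈ InU' := by
      rintro ω₁ ω₂ h ⟨w', hw', v', hv', h1, h2⟩
      exact ⟨w', hw', v', hv',
        Percolation.BlockExploration.openConnIn_of_agree h1 fun a ha b _ hab => hagA h a ha b hab,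
        hagA h v' hv' w' h2⟩
    exact fun ω₁ ω₂ h => ⟨aux ω₁ ω₂ h, aux ω₂ ω₁ h.symm⟩
  /- an open `G`-edge with no endpoint in `U'` is read off `T` -/
  have hagC : ∀ {ω₁ ω₂ : BondConfig V},
      ω₁ ∩ (↑(G.edgeFinset \ T)) = ω₂ ∩ (↑(G.edgeFinset \ T)) →
      ∀ a b : V, a ∉ U' → b ∉ U' → s(a, b) ∈ ω₁ ∩ Eg → s(a, b) ∈ ω₂ ∩ Eg := by
    rintro ω₁ ω₂ h a b ha hb ⟨hab, habE⟩
    have habT : s(a, b) ∉ T := fun h' => by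
      obtain ⟨-, v, hv, hve⟩ := (hT _).1 h'
      rcases Sym2.mem_iff.1 hve with rfl | rfl
      · exact ha hv
      · exact hb hv
    have hmem : s(a, b) ∈ ω₁ ∩ (↑(G.edgeFinset \ T) : Set (Sym2 V)) :=
      ⟨hab, Finset.mem_coe.2 (Finset.mem_sdiff.2 ⟨habE, habT⟩)⟩
    rw [h] at hmem
    exact ⟨hmem.1, habE⟩
  /- (ii') `Fo ∩ Mid` is determined by `ω ∩ (E(G) ∖ T)` -/
  have hC : ∀ ω₁ ω₂ : BondConfig V,
      ω₁ ∩ (↑(G.edgeFinset \ T)) = ω₂ ∩ (↑(G.edgeFinset \ T)) → (ω₁ ∈ Fo ∩ Mid ↔ ω₂ ∈ Fo ∩ Mid) := by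
    have aux : ∀ ω₁ ω₂ : BondConfig V,
        ω₁ ∩ (↑(G.edgeFinset \ T)) = ω₂ ∩ (↑(G.edgeFinset \ T)) → ω₁ ∈ Mid → ω₂ ∈ Mid := by
      rintro ω₁ ω₂ h ⟨w'', hw'', v, hv, w, hw, h1, h2⟩
      obtain ⟨_, hvU, _⟩ := id h1
      exact ⟨w'', hw'', v, hv, w, hw,
        Percolation.BlockExploration.openConnIn_of_agree h1 fun a ha b hb hab =>
          hagC h a b ha.2 hb.2 hab,
        hagC h v w hvU.2 (hR w hw).1 h2⟩
    intro ω₁ ω₂ h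
    exact ⟨fun h' => ⟨(hFo ω₁ ω₂ h).1 h'.1, aux ω₁ ω₂ h h'.2⟩,
      fun h' => ⟨(hFo ω₁ ω₂ h).2 h'.1, aux ω₂ ω₁ h.symm h'.2⟩⟩
  by_cases hRS : ∀ r ∈ R', r ∉ U'
  · /- (iii) conditional independence given `F` -/
    obtain ⟨hFdet, hFrim, hFwire⟩ := explEvent_wiredOff_rimHyps G In' Blk' U' R' T hT
    have key := rcMeasure_real_condIndep_of_rim_wired_outside G hp hq ∅ U' R' T hT hRS
      (fun b hb => absurd hb (Set.notMem_empty b)) F hFdet hFrim hFwire InU' (Fo ∩ Mid) hA hC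
    have e1 : F ∩ Fo ∩ InU = F ∩ InU' ∩ (Fo ∩ Mid) := by
      rw [Set.inter_right_comm, hset, Set.inter_assoc, Set.inter_comm Mid Fo]
    have e2 : F ∩ Fo ∩ Mid = F ∩ (Fo ∩ Mid) := Set.inter_assoc _ _ _
    rw [e1, e2]
    exact key
  · /- degenerate case: `R'` meets `U'`, so the datum event is empty -/
    have hF0 : F = ∅ := by
      refine Set.eq_empty_iff_forall_notMem.2 fun ω hω => hRS fun r hr hrU' => ?_
      obtain ⟨⟨h1, h2⟩, -⟩ := hω
      rw [← h1] at hrU'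
      rw [← h2] at hr
      exact (Percolation.mem_explRim_iff.1 hr).1 hrU'
    rw [hF0]
    simp only [Set.empty_inter, measureReal_empty, mul_zero]

/-- **(CH-sum, rim wired off the inside) One level of Kesten's chain.** With `U ⊇ In' ∪ Blk'`
containing every `G`-neighbour of `In' ∪ Blk'`, `R ∩ U = ∅`, `x ∈ In'`, and `Fo` determined by the
`G`-edges with no endpoint in `In' ∪ Blk'`: partitioning `Fo ∩ InU` according to the actual inner
datum `d' = (𝒞, 𝒟)` of `ω ∩ E(G)` (explored set of `Blk'` from `In'` and its rim) and to whether
the rim is wired off the inside (through `𝒞 ∖ In'`),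
`φ(Fo ∩ InU) = Σ_{d'} φ(F(d') ∩ Fo ∩ Mid(d')) · (φ(F(d') ∩ InU'(d')) / φ(F(d'))) + φ(Fo ∩ InU ∩
{rim not wired off In'})`: on `F(d')` apply `insidePiece_factorisation_off` (its side conditions
hold as soon as `F(d')` is nonempty; if `φ(F(d')) = 0` both sides of the summand vanish).
[cite: Kesten1986, proof of Thm. 3, eqs. (16)–(19)] -/
theorem insidePiece_eq_sum_add_notWiredOff :
    ∀ {V : Type*} [Fintype V] [DecidableEq V] (G : SimpleGraph V) [DecidableRel G.Adj] {p q : ℝ},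
      p ∈ Set.Icc (0 : ℝ) 1 → 0 < q →
    ∀ (In' Blk' U R : Set V),
      In' ⊆ U → Blk' ⊆ U →
      (∀ v ∈ In' ∪ Blk', ∀ w : V, G.Adj v w → w ∈ U) →
      (∀ r ∈ R, r ∉ U) →
    ∀ (x : V), x ∈ In' →
    ∀ (Fo : Set (BondConfig V)),
      (∀ ω₁ ω₂ : BondConfig V, (∀ e ∈ G.edgeFinset, (∀ v ∈ e, v ∉ In' ∧ v ∉ Blk') → (e ∈ ω₁ ↔ e ∈ ω₂)) →
        (ω₁ ∈ Fo ↔ ω₂ ∈ Fo)) →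
      let Eg : Set (Sym2 V) := ↑G.edgeFinset
      let P := rcMeasure G p q ∅
      let F : Set V → Set V → Set (BondConfig V) := fun U' R' => {ω | ω ∩ Eg ∈ explEvent In' Blk' U' R' ∩
        {ω | ∀ r ∈ R', ∀ r₂ ∈ R', ∃ v ∈ U' \ In', ∃ v' ∈ U' \ In', s(v, r) ∈ ω ∧ s(v', r₂) ∈ ω ∧ ω ∈ openConnIn (U' \ In') v v'}}
      let InU : Set (BondConfig V) := {ω | ∃ w ∈ R, ∃ v ∈ U, ω ∩ Eg ∈ openConnIn U x v ∧ s(v, w) ∈ ω ∩ Eg}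
      let InU' : Set V → Set V → Set (BondConfig V) := fun U' R' =>
        {ω | ∃ w' ∈ R', ∃ v' ∈ U', ω ∩ Eg ∈ openConnIn U' x v' ∧ s(v', w') ∈ ω ∩ Eg}
      let Mid : Set V → Set V → Set (BondConfig V) := fun U' R' =>
        {ω | ∃ w'' ∈ R', ∃ v ∈ U, ∃ w ∈ R, ω ∩ Eg ∈ openConnIn (U \ U') w'' v ∧ s(v, w) ∈ ω ∩ Eg}
      let NW : Set (BondConfig V) := {ω | ¬ (∀ r ∈ explRim In' Blk' (ω ∩ Eg), ∀ r₂ ∈ explRim In' Blk' (ω ∩ Eg),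
        ∃ v ∈ explSet In' Blk' (ω ∩ Eg) \ In', ∃ v' ∈ explSet In' Blk' (ω ∩ Eg) \ In',
          s(v, r) ∈ ω ∩ Eg ∧ s(v', r₂) ∈ ω ∩ Eg ∧ ω ∩ Eg ∈ openConnIn (explSet In' Blk' (ω ∩ Eg) \ In') v v')}
      P.real (Fo ∩ InU) =
        (∑ d ∈ (Finset.univ : Finset (Finset V × Finset V)),
          P.real (F ↑d.1 ↑d.2 ∩ Fo ∩ Mid ↑d.1 ↑d.2) *
            (P.real (F ↑d.1 ↑d.2 ∩ InU' ↑d.1 ↑d.2) / P.real (F ↑d.1 ↑d.2))) +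
          P.real (Fo ∩ InU ∩ NW) := by
  intro V _ _ G _ p q hp hq In' Blk' U R hIn'U hBlk'U hnb hRU x hx Fo hFo Eg P F InU InU' Mid NW
  classical
  haveI : IsProbabilityMeasure P := isProbabilityMeasure_rcMeasure G hp hq ∅
  /- Step A: on each datum event the summand is the probability of `F d ∩ Fo ∩ InU` -/
  have stepA : ∀ d : Finset V × Finset V,
      P.real (F ↑d.1 ↑d.2 ∩ Fo ∩ InU) =
        P.real (F ↑d.1 ↑d.2 ∩ Fo ∩ Mid ↑d.1 ↑d.2) *
          (P.real (F ↑d.1 ↑d.2 ∩ InU' ↑d.1 ↑d.2) / P.real (F ↑d.1 ↑d.2)) := by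
    intro d
    by_cases h0 : P.real (F ↑d.1 ↑d.2) = 0
    · rw [h0, div_zero, mul_zero]
      exact measureReal_mono_null (fun ω hω => hω.1.1) h0
    · -- the datum event is nonempty, whence the side conditions of (CH-prob)
      obtain ⟨ω₀, hω₀⟩ : (F ↑d.1 ↑d.2).Nonempty :=
        Set.nonempty_iff_ne_empty.2 fun h => h0 (by rw [h, measureReal_empty])
      obtain ⟨⟨hS, hRim⟩, -⟩ := hω₀
      have hd1 : (↑d.1 : Set V) ⊆ In' ∪ Blk' := by
        rw [← hS]
        exact Percolation.explSet_subset In' Blk' _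
      have hd1U : (↑d.1 : Set V) ⊆ U := hd1.trans (Set.union_subset hIn'U hBlk'U)
      have hd2U : (↑d.2 : Set V) ⊆ U := by
        intro w hw
        rw [← hRim] at hw
        obtain ⟨-, v, hv, hvw⟩ := Percolation.mem_explRim_iff.1 hw
        have hvwE : s(v, w) ∈ G.edgeFinset := hvw.2
        exact hnb v (Percolation.explSet_subset In' Blk' _ hv) w
          (SimpleGraph.mem_edgeFinset.1 hvwE)
      have hRd : ∀ r ∈ R, r ∉ (↑d.1 : Set V) ∧ r ∉ (↑d.2 : Set V) :=
        fun r hr => ⟨fun h => hRU r hr (hd1U h), fun h => hRU r hr (hd2U h)⟩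
      have hxd : x ∈ (↑d.1 : Set V) := by
        rw [← hS]
        exact Percolation.subset_explSet In' Blk' _ hx
      -- the `G`-edges touching the inner explored set
      obtain ⟨T, hT⟩ : ∃ T : Finset (Sym2 V), ∀ e, e ∈ T ↔ e ∈ G.edgeFinset ∧ ∃ v ∈ (↑d.1 : Set V), v ∈ e :=
        ⟨G.edgeFinset.filter fun e => ∃ v ∈ (↑d.1 : Set V), v ∈ e, fun e => Finset.mem_filter⟩
      have hFoT : ∀ ω₁ ω₂ : BondConfig V,
          ω₁ ∩ (↑(G.edgeFinset \ T)) = ω₂ ∩ (↑(G.edgeFinset \ T)) → (ω₁ ∈ Fo ↔ ω₂ ∈ Fo) := by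
        intro ω₁ ω₂ h
        refine hFo ω₁ ω₂ fun e he hout => ?_
        have heT : e ∉ T := fun heT => by
          obtain ⟨-, v, hv, hve⟩ := (hT e).1 heT
          rcases hd1 hv with hvIn | hvBlk
          · exact (hout v hve).1 hvIn
          · exact (hout v hve).2 hvBlk
        have he' : e ∈ (↑(G.edgeFinset \ T) : Set (Sym2 V)) :=
          Finset.mem_coe.2 (Finset.mem_sdiff.2 ⟨he, heT⟩)
        exact ⟨fun h1 => ((Set.ext_iff.1 h e).1 ⟨h1, he'⟩).1,
          fun h2 => ((Set.ext_iff.1 h e).2 ⟨h2, he'⟩).1⟩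
      have key : P.real (F ↑d.1 ↑d.2 ∩ Fo ∩ InU) * P.real (F ↑d.1 ↑d.2) =
          P.real (F ↑d.1 ↑d.2 ∩ InU' ↑d.1 ↑d.2) * P.real (F ↑d.1 ↑d.2 ∩ Fo ∩ Mid ↑d.1 ↑d.2) :=
        insidePiece_factorisation_off G hp hq In' Blk' (↑d.1) (↑d.2) U R T hT hd1U hd2U hRd x hxd
          Fo hFoT
      rw [mul_div_assoc', eq_div_iff h0, key, mul_comm]
  /- Step B: partition of `Fo ∩ InU` by the actual inner datum of `ω ∩ E(G)` -/
  have hmeas : ∀ s : Set (BondConfig V), MeasurableSet s := fun s =>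
    (Set.to_countable s).measurableSet
  have hFiff : ∀ (d : Finset V × Finset V) (ω : BondConfig V), ω ∈ F ↑d.1 ↑d.2 ↔
      (explSet In' Blk' (ω ∩ Eg) = ↑d.1 ∧ explRim In' Blk' (ω ∩ Eg) = ↑d.2) ∧
        (∀ r ∈ explRim In' Blk' (ω ∩ Eg), ∀ r₂ ∈ explRim In' Blk' (ω ∩ Eg),
          ∃ v ∈ explSet In' Blk' (ω ∩ Eg) \ In', ∃ v' ∈ explSet In' Blk' (ω ∩ Eg) \ In',
            s(v, r) ∈ ω ∩ Eg ∧ s(v', r₂) ∈ ω ∩ Eg ∧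
              ω ∩ Eg ∈ openConnIn (explSet In' Blk' (ω ∩ Eg) \ In') v v') := by
    intro d ω
    constructor
    · rintro ⟨⟨h1, h2⟩, hW⟩
      refine ⟨⟨h1, h2⟩, ?_⟩
      rw [h1, h2]
      exact hW
    · rintro ⟨⟨h1, h2⟩, hW⟩
      rw [h1, h2] at hW
      exact ⟨⟨h1, h2⟩, hW⟩
  have hUnion : Fo ∩ InU ∩ NWᶜ =
      ⋃ d ∈ (Finset.univ : Finset (Finset V × Finset V)), (F ↑d.1 ↑d.2 ∩ Fo ∩ InU) := by
    ext ω
    rw [Set.mem_iUnion₂]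
    constructor
    · rintro ⟨⟨hFo', hIn⟩, hNW⟩
      refine ⟨((Set.toFinite (explSet In' Blk' (ω ∩ Eg))).toFinset,
        (Set.toFinite (explRim In' Blk' (ω ∩ Eg))).toFinset), Finset.mem_univ _, ⟨?_, hFo'⟩, hIn⟩
      rw [hFiff]
      simp only [Set.Finite.coe_toFinset, true_and]
      exact Classical.byContradiction (Set.notMem_of_mem_compl hNW)
    · rintro ⟨d, -, ⟨hF', hFo'⟩, hIn⟩
      exact ⟨⟨hFo', hIn⟩, Set.mem_compl fun h => h ((hFiff d ω).1 hF').2⟩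
  have hdisj : (↑(Finset.univ : Finset (Finset V × Finset V)) : Set (Finset V × Finset V)).PairwiseDisjoint
      fun d => F ↑d.1 ↑d.2 ∩ Fo ∩ InU := by
    intro d _ d' _ hne
    dsimp only [Function.onFun]
    rw [Set.disjoint_left]
    rintro ω ⟨⟨hF1, -⟩, -⟩ ⟨⟨hF2, -⟩, -⟩
    obtain ⟨⟨h1, h2⟩, -⟩ := (hFiff d ω).1 hF1
    obtain ⟨⟨h1', h2'⟩, -⟩ := (hFiff d' ω).1 hF2
    exact hne (Prod.ext (Finset.coe_injective (h1.symm.trans h1'))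
      (Finset.coe_injective (h2.symm.trans h2')))
  have hsum : ∑ d ∈ (Finset.univ : Finset (Finset V × Finset V)),
      P.real (F ↑d.1 ↑d.2 ∩ Fo ∩ Mid ↑d.1 ↑d.2) *
        (P.real (F ↑d.1 ↑d.2 ∩ InU' ↑d.1 ↑d.2) / P.real (F ↑d.1 ↑d.2)) =
      ∑ d ∈ (Finset.univ : Finset (Finset V × Finset V)), P.real (F ↑d.1 ↑d.2 ∩ Fo ∩ InU) :=
    Finset.sum_congr rfl fun d _ => (stepA d).symm
  rw [hsum, ← measureReal_biUnion_finset hdisj fun d _ => hmeas _, ← hUnion,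
    ← measureReal_inter_add_sdiff (s := Fo ∩ InU) (hmeas NWᶜ), Set.sdiff_compl]

end Literature.Probability.LatticeModels
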